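import Summits.HubbardSuperconductivity.HubbardSuperconductivity.Theses.ParityGapRigidity
import Literature.MathematicalPhysics.QuantumLattice.HubbardRingPerronFrobeniusProofs

/-!
# `NoUniformParityGap` against `GappedWindow` (route ParityGapRigidity, bookkeeping)

Item stmt-HubbardSuperconductivity-2198, `NoUniformParityGap`, is the route's *kill criterion*: at
EVERY repulsive coupling `U > 0` and EVERY hole doping `δ ∈ (0, 1/2)` the pure `t' = 0` Hubbard torus
family has no `L`-uniform one-particle parity gap `E(N_L+1) + E(N_L-1) - 2 E₀(N_L, S^z = 0) ≥ 2Δ > 0`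
along even sides. It is, literally, the pointwise negation of the parity-gap clause (PG) of the crux
`GappedWindow` (stmt-HubbardSuperconductivity-2196) at every `(U, δ)`.

This file machine-checks that bookkeeping and nothing more:

* `not_gappedWindow_of_noUniformParityGap` — a proof of the kill criterion refutes `GappedWindow`
  (so it would close the route negatively, as the route card says);
* `not_noUniformParityGap_of_gappedWindow` — conversely a proof of `GappedWindow` refutes the kill
  criterion: the two items are mutually exclusive;
* `noUniformParityGap_iff` — the `push_neg` normal form a refuter instrument (ED/DMRG parity-gap maps)
  would have to certify: for every `Δ > 0` and every threshold `L₀` some even `L ≥ L₀` has parity gap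
  `< 2Δ`;
* `parityGap_eq_chargeGap`, `noUniformParityGap_iff_chargeGap` — by the tree's `SU(2)` theorem
  `groundEnergyAt_eq_minEnergyOn_szSector` (every spin multiplet has an `S^z = 0` member) the sector
  energy `E₀(N_L, S^z = 0)` IS the `N_L`-particle ground energy, so the item's parity gap is exactly the
  Lieb–Wu charge gap `chargeGap (fermionTorusGraph 2 L) 1 U N_L = E(N_L+1) + E(N_L-1) - 2E(N_L)` and the
  kill criterion reads: no `L`-uniform positive lower bound on `Δ_c(N_L)` along even `L`, at any
  `U > 0`, `δ ∈ (0, 1/2)` — the spin-sector restriction is immaterial.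

Neither `NoUniformParityGap` nor its negation is proved here or anywhere in print: deciding it is the
question whether the two-dimensional repulsive Hubbard model has, at some density `1 - δ ∈ (1/2, 1)`, a
fully one-particle-gapped ground state (chiral `d + id` sliver, filled-stripe insulator, …) — open.
-/

-- the mandated namespace `Summit.<Summit>.<Problem>.Theorems` repeats `HubbardSuperconductivity`
-- (single-problem summit, D-0017), which the `dupNamespace` linter flags on every declaration
set_option linter.dupNamespace false

namespace Summit.HubbardSuperconductivity.HubbardSuperconductivity.Theorems

open Summit.HubbardSuperconductivity.HubbardSuperconductivity.Theses.ParityGapRigidity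

/-- The kill criterion of route ParityGapRigidity does what the route card says: `NoUniformParityGap`
(no uniform parity gap at ANY `(U, δ)`) contradicts the parity-gap clause of `GappedWindow` at the
window's own `(U, δ)`, hence refutes `GappedWindow`. Pure bookkeeping. -/
theorem not_gappedWindow_of_noUniformParityGap (h : NoUniformParityGap) : ¬ GappedWindow := by
  rintro ⟨U, hU, δ, hδ, hPG, -⟩
  exact h U δ hU hδ hPG

/-- Conversely, the crux `GappedWindow` refutes the kill criterion: items
stmt-HubbardSuperconductivity-2196 and stmt-HubbardSuperconductivity-2198 are mutually exclusive.
Pure bookkeeping. -/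
theorem not_noUniformParityGap_of_gappedWindow (hW : GappedWindow) : ¬ NoUniformParityGap :=
  fun h => not_gappedWindow_of_noUniformParityGap h hW

/-- Normal form of the kill criterion (what a parity-gap map would have to certify): for every `U > 0`,
`δ ∈ (0, 1/2)`, `Δ > 0` and threshold `L₀` there is an even side `L ≥ L₀` whose parity gap about the
`(N_L, S^z = 0)` ground energy, `N_L = 2⌊(1-δ)L²/2⌋`, is `< 2Δ`. -/
theorem noUniformParityGap_iff :
    NoUniformParityGap ↔
      ∀ (U δ : ℝ), 0 < U → δ ∈ Set.Ioo (0 : ℝ) (1 / 2) → ∀ Δ : ℝ, 0 < Δ → ∀ L₀ : ℕ,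
        ∃ L ≥ L₀, Even L ∧
          Literature.MathematicalPhysics.QuantumLattice.groundEnergy
                (Literature.MathematicalPhysics.QuantumLattice.hubbardTorus 2 L 1 U)
                (2 * ⌊(1 - δ) * (L : ℝ) ^ 2 / 2⌋₊ + 1) +
              Literature.MathematicalPhysics.QuantumLattice.groundEnergy
                (Literature.MathematicalPhysics.QuantumLattice.hubbardTorus 2 L 1 U)
                (2 * ⌊(1 - δ) * (L : ℝ) ^ 2 / 2⌋₊ - 1) -
            2 * Matrix.minEnergyOn
                (Literature.MathematicalPhysics.QuantumLattice.hubbardTorus 2 L 1 U)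
                (Literature.MathematicalPhysics.QuantumLattice.szSector
                  (2 * ⌊(1 - δ) * (L : ℝ) ^ 2 / 2⌋₊) 0) < 2 * Δ := by
  unfold NoUniformParityGap
  constructor
  · intro h U δ hU hδ Δ hΔ L₀
    by_contra hcon
    push Not at hcon
    exact h U δ hU hδ ⟨Δ, hΔ, L₀, fun L hL hev Hm hHm => hHm ▸ hcon L hL hev⟩
  · intro h U δ hU hδ ⟨Δ, hΔ, L₀, hPG⟩
    obtain ⟨L, hL, hev, hlt⟩ := h U δ hU hδ Δ hΔ L₀
    exact absurd (hPG L hL hev _ rfl) (not_le.mpr hlt)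

end Summit.HubbardSuperconductivity.HubbardSuperconductivity.Theorems

/-! ### Charge-gap form: the `S^z = 0` restriction is immaterial (`SU(2)`) -/

namespace Summit.HubbardSuperconductivity.HubbardSuperconductivity.Theorems

open Summit.HubbardSuperconductivity.HubbardSuperconductivity.Theses.ParityGapRigidity
open Literature.MathematicalPhysics.QuantumLattice

/-- Half the sector particle number fits on the torus: `⌊(1-δ)L²/2⌋ ≤ L² = |(ℤ/Lℤ)²|` for `0 ≤ δ`. -/
theorem half_sectorNumber_le_card {δ : ℝ} (hδ : 0 ≤ δ) (L : ℕ) :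
    ⌊(1 - δ) * (L : ℝ) ^ 2 / 2⌋₊ ≤ Fintype.card (FermionTorus 2 L) := by
  have hcard : Fintype.card (FermionTorus 2 L) = L ^ 2 := by simp [FermionTorus, Fintype.card_fin]
  rw [hcard]
  have hx : (1 - δ) * (L : ℝ) ^ 2 / 2 ≤ ((L ^ 2 : ℕ) : ℝ) := by
    push_cast
    nlinarith [sq_nonneg (L : ℝ)]
  calc ⌊(1 - δ) * (L : ℝ) ^ 2 / 2⌋₊ ≤ ⌊((L ^ 2 : ℕ) : ℝ)⌋₊ := Nat.floor_le_floor hx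
    _ = L ^ 2 := Nat.floor_natCast _

/-- **`SU(2)` removes the `S^z` bookkeeping.** On every torus and for every even particle number
`2n`, `n ≤ L²`, the lowest energy of `hubbardTorus 2 L 1 U` in the joint sector `(2n, S^z = 0)` is the
plain `2n`-particle ground energy `E(2n)`: every spin multiplet of the `2n`-particle ground level has
an `S^z = 0` member (tree theorem `groundEnergyAt_eq_minEnergyOn_szSector`; Lieb, PRL 62 (1989) 1201,
proof of Theorem 1). -/
theorem minEnergyOn_szSector_zero_eq_groundEnergy (U : ℝ) (L n : ℕ)
    (hn : n ≤ Fintype.card (FermionTorus 2 L)) :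
    Matrix.minEnergyOn (hubbardTorus 2 L 1 U) (szSector (2 * n) 0) =
      groundEnergy (hubbardTorus 2 L 1 U) (2 * n) :=
  (groundEnergyAt_eq_minEnergyOn_szSector (fermionTorusGraph 2 L) 1 U hn).symm

/-- **The item's parity gap is the Lieb–Wu charge gap.** For `0 ≤ δ` the quantity bounded below in
`GappedWindow` / negated in `NoUniformParityGap`, `E(N_L+1) + E(N_L-1) - 2E₀(N_L, S^z = 0)` with
`N_L = 2⌊(1-δ)L²/2⌋`, equals `chargeGap (fermionTorusGraph 2 L) 1 U N_L = E(N_L+1) + E(N_L-1) - 2E(N_L)`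
(Lieb–Wu, PRL 20 (1968) 1445, eq. (17)): no spin-sector restriction remains. -/
theorem parityGap_eq_chargeGap (U : ℝ) {δ : ℝ} (hδ : 0 ≤ δ) (L : ℕ) :
    groundEnergy (hubbardTorus 2 L 1 U) (2 * ⌊(1 - δ) * (L : ℝ) ^ 2 / 2⌋₊ + 1) +
        groundEnergy (hubbardTorus 2 L 1 U) (2 * ⌊(1 - δ) * (L : ℝ) ^ 2 / 2⌋₊ - 1) -
      2 * Matrix.minEnergyOn (hubbardTorus 2 L 1 U) (szSector (2 * ⌊(1 - δ) * (L : ℝ) ^ 2 / 2⌋₊) 0) =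
    chargeGap (fermionTorusGraph 2 L) 1 U (2 * ⌊(1 - δ) * (L : ℝ) ^ 2 / 2⌋₊) := by
  rw [minEnergyOn_szSector_zero_eq_groundEnergy U L _ (half_sectorNumber_le_card hδ L)]
  rfl

/-- **Charge-gap form of the kill criterion.** `NoUniformParityGap` is, verbatim up to the `SU(2)`
identity `E₀(N_L, S^z = 0) = E(N_L)`, the statement that for every `U > 0` and `δ ∈ (0, 1/2)` the
Lieb–Wu charge gap `Δ_c(N_L) = E(N_L+1) + E(N_L-1) - 2E(N_L)` of the pure Hubbard torus admits no
positive lower bound uniform in the even sides `L` — the quantity an ED/DMRG charge-gap map reads. -/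
theorem noUniformParityGap_iff_chargeGap :
    NoUniformParityGap ↔
      ∀ (U δ : ℝ), 0 < U → δ ∈ Set.Ioo (0 : ℝ) (1 / 2) →
        ¬ ∃ Δ : ℝ, 0 < Δ ∧ ∃ L₀ : ℕ, ∀ L ≥ L₀, Even L →
          2 * Δ ≤ chargeGap (fermionTorusGraph 2 L) 1 U (2 * ⌊(1 - δ) * (L : ℝ) ^ 2 / 2⌋₊) := by
  unfold NoUniformParityGap
  refine forall₄_congr fun U δ _ hδ => not_congr ?_
  refine exists_congr fun Δ => and_congr_right fun _ => exists_congr fun L₀ => ?_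
  refine forall₃_congr fun L _ _ => ?_
  constructor
  · intro h
    rw [← parityGap_eq_chargeGap U hδ.1.le L]
    exact h _ rfl
  · intro h Hm hHm
    subst hHm
    rw [parityGap_eq_chargeGap U hδ.1.le L]
    exact h

end Summit.HubbardSuperconductivity.HubbardSuperconductivity.Theorems
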